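import Mathlib
import HarnessLib

/-!
# The cover monoid of a family of subsets and its standard Veronese level (Herzog–Hibi–Trung 2007, Thm. 1.1 + Thm. 2.1 / Cor. 2.2, combinatorial core)

Topic: `Literature/Combinatorics/Optimization` (integer points of rational polyhedral cones; companion of
`HilbertBasis.lean`). For a natural number `d` and a finite family `𝒮` of subsets of `Fin d` consider the
exponent sets

  `E_n(𝒮) = {c : Fin d → ℕ | ∀ S ∈ 𝒮, n ≤ ∑_{i ∈ S} c i}`      (`n : ℕ`),

i.e. the exponents of the monomials lying in the `n`-th symbolic power `⋂_{S ∈ 𝒮} 𝔭_S^n` of the squarefree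
monomial ideal `⋂_{S ∈ 𝒮} 𝔭_S`, `𝔭_S = (X_i : i ∈ S)` (Herzog–Hibi–Trung's vertex cover algebra of the
hypergraph `𝒮`). The graded monoid `H(𝒮) = {(c, n) | c ∈ E_n(𝒮)} ⊆ ℕ^d × ℕ` is the monoid of lattice
points of a rational polyhedral cone, hence finitely generated (Gordan's lemma; here through the slack
presentation and Mathlib's Gordan–Dickson lemma `AddSubmonoid.fg_eqLocusM`), and a finitely generated graded
monoid has a STANDARD Veronese sub-monoid (Herzog–Hibi–Trung 2007, Thm. 2.1 (a) ⇒ (b)): there is `b₀ > 0`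
with

  `E_{k b₀}(𝒮) = E_{b₀}(𝒮) + ⋯ + E_{b₀}(𝒮)`  (`k` summands) for every `k`

(`exists_veronese_level`, stated as: every `c ∈ E_{k b₀}` dominates a sum of `k` members of `E_{b₀}`). This
is the combinatorial content of [HerzogHibiTrung2007, Cor. 2.2] «Let `I_1, …, I_r ⊂ S` be monomial ideals.
Then there exists an integer `d` such that `(⋂_j I_j^d)^k = ⋂_j I_j^{dk}` for all `k ≥ 1`» in the case of
monomial prime ideals `I_j = 𝔭_{S_j}`; the transfer to ideals (in a polynomial ring, or in a regular local
ring along a regular system of parameters) is done in `AlgebraicGeometry/Resolution/SymbolicPowersMonomialVeronese.lean`.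
By [HerzogHibiTrung2007, Rem. 2.4] the good levels do NOT form a final segment of `ℕ`; what is true (and
used downstream) is that every multiple of a good level is good (`veronese_level_mul`).

Everything is PROVED; no definitions besides the two predicates `Covers` / `coverMonoid`.

## Sources
* J. Herzog, T. Hibi, N. V. Trung, *Symbolic powers of monomial ideals and vertex cover algebras*,
  Adv. Math. 210 (2007) 304–322: Thm. 1.1 (Gordan-type finite generation), Thm. 2.1, Cor. 2.2, Rem. 2.4.
  [HerzogHibiTrung2007]
* A. Schrijver, *Theory of Linear and Integer Programming* (1986), Thm. 16.4 (Gordan; tree `HilbertBasis.lean`).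
  [Schrijver1986]
-/

namespace Literature.Combinatorics.Optimization.CoverMonoid

open Finset

variable {d : ℕ}

/-- `Covers 𝒮 n c`: the exponent vector `c : Fin d → ℕ` has `S`-degree `≥ n` for every `S ∈ 𝒮`
(`c ∈ E_n(𝒮)`; for monomials: `X^c ∈ ⋂_{S ∈ 𝒮} 𝔭_S^n`). [cite: HerzogHibiTrung2007, §4 (vertex cover algebra), Thm. 2.1] -/
def Covers (𝒮 : Finset (Finset (Fin d))) (n : ℕ) (c : Fin d → ℕ) : Prop :=
  ∀ S ∈ 𝒮, n ≤ ∑ i ∈ S, c i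

/-- Degree `0` imposes no condition. [cite: HerzogHibiTrung2007, Thm. 2.1] -/
theorem covers_zero (𝒮 : Finset (Finset (Fin d))) (c : Fin d → ℕ) : Covers 𝒮 0 c :=
  fun _ _ => Nat.zero_le _

/-- `E_n` is decreasing in `n`. [cite: HerzogHibiTrung2007, Thm. 2.1] -/
theorem Covers.mono_left {𝒮 : Finset (Finset (Fin d))} {m n : ℕ} {c : Fin d → ℕ} (h : Covers 𝒮 n c)
    (hmn : m ≤ n) : Covers 𝒮 m c :=
  fun S hS => hmn.trans (h S hS)

/-- `E_n` is an upper set. [cite: HerzogHibiTrung2007, Thm. 2.1] -/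
theorem Covers.mono_right {𝒮 : Finset (Finset (Fin d))} {n : ℕ} {c c' : Fin d → ℕ} (h : Covers 𝒮 n c)
    (hcc : c ≤ c') : Covers 𝒮 n c' :=
  fun S hS => (h S hS).trans (Finset.sum_le_sum fun i _ => hcc i)

/-- `E_m + E_n ⊆ E_{m+n}`. [cite: HerzogHibiTrung2007, Thm. 2.1] -/
theorem Covers.add {𝒮 : Finset (Finset (Fin d))} {m n : ℕ} {c c' : Fin d → ℕ} (h : Covers 𝒮 m c)
    (h' : Covers 𝒮 n c') : Covers 𝒮 (m + n) (c + c') := fun S hS => by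
  rw [show (∑ i ∈ S, (c + c') i) = (∑ i ∈ S, c i) + ∑ i ∈ S, c' i from by
    simp only [Pi.add_apply, Finset.sum_add_distrib]]
  exact Nat.add_le_add (h S hS) (h' S hS)

/-- Sums: `∑_j E_{n_j} ⊆ E_{∑ n_j}`. [cite: HerzogHibiTrung2007, Thm. 2.1] -/
theorem Covers.sum {𝒮 : Finset (Finset (Fin d))} {ι : Type*} (s : Finset ι) {n : ι → ℕ}
    {c : ι → Fin d → ℕ} (h : ∀ j ∈ s, Covers 𝒮 (n j) (c j)) : Covers 𝒮 (∑ j ∈ s, n j) (∑ j ∈ s, c j) := by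
  classical
  induction s using Finset.induction_on with
  | empty => simpa using covers_zero 𝒮 0
  | insert a s ha ih =>
    rw [Finset.sum_insert ha, Finset.sum_insert ha]
    exact (h a (Finset.mem_insert_self a s)).add (ih fun j hj => h j (Finset.mem_insert_of_mem hj))

/-- **The cover monoid** `H(𝒮) = {(c, n) | c ∈ E_n(𝒮)} ⊆ ℕ^d × ℕ`, graded by the second coordinate (the
monoid of the vertex cover algebra of the hypergraph `𝒮`). [cite: HerzogHibiTrung2007, §4, Thm. 4.2] -/
def coverMonoid (𝒮 : Finset (Finset (Fin d))) : AddSubmonoid ((Fin d → ℕ) × ℕ) where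
  carrier := {h | Covers 𝒮 h.2 h.1}
  zero_mem' := covers_zero 𝒮 0
  add_mem' := fun ha hb => Covers.add ha hb

/-- Membership in the cover monoid. [cite: HerzogHibiTrung2007, §4] -/
@[simp] theorem mem_coverMonoid {𝒮 : Finset (Finset (Fin d))} {h : (Fin d → ℕ) × ℕ} :
    h ∈ coverMonoid 𝒮 ↔ Covers 𝒮 h.2 h.1 :=
  Iff.rfl

/-! ## Gordan: the cover monoid is finitely generated -/

section Gordan

variable (𝒮 : Finset (Finset (Fin d)))

/-- Index type of the slack presentation: coordinates `c_i`, the degree `n`, and one slack `s_S` per `S ∈ 𝒮`.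
[cite: HerzogHibiTrung2007, Thm. 1.1] -/
abbrev SlackIdx (𝒮 : Finset (Finset (Fin d))) : Type := (Fin d ⊕ (Unit ⊕ {S : Finset (Fin d) // S ∈ 𝒮})) → ℕ

/-- `t ↦ (S ↦ ∑_{i ∈ S} t_i)`. [cite: HerzogHibiTrung2007, Thm. 1.1] -/
def lhsHom : SlackIdx 𝒮 →+ ({S : Finset (Fin d) // S ∈ 𝒮} → ℕ) where
  toFun t := fun S => ∑ i ∈ S.1, t (Sum.inl i)
  map_zero' := by ext S; simp
  map_add' := fun _ _ => by ext S; simp [Finset.sum_add_distrib]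

/-- `t ↦ (S ↦ n + s_S)`. [cite: HerzogHibiTrung2007, Thm. 1.1] -/
def rhsHom : SlackIdx 𝒮 →+ ({S : Finset (Fin d) // S ∈ 𝒮} → ℕ) where
  toFun t := fun S => t (Sum.inr (Sum.inl ())) + t (Sum.inr (Sum.inr S))
  map_zero' := by ext S; simp
  map_add' := fun _ _ => by ext S; simp only [Pi.add_apply]; ring

/-- `t ↦ (c, n)`. [cite: HerzogHibiTrung2007, Thm. 1.1] -/
def projHom : SlackIdx 𝒮 →+ ((Fin d → ℕ) × ℕ) where
  toFun t := (fun i => t (Sum.inl i), t (Sum.inr (Sum.inl ())))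
  map_zero' := rfl
  map_add' := fun _ _ => rfl

/-- **Slack presentation**: `H(𝒮)` is the image of the equaliser `{t | ∑_{i∈S} t_i = n + s_S ∀ S}` under
`t ↦ (c, n)`. [cite: HerzogHibiTrung2007, Thm. 1.1] -/
theorem coverMonoid_eq_map : coverMonoid 𝒮 = AddSubmonoid.map (projHom 𝒮) ((lhsHom 𝒮).eqLocusM (rhsHom 𝒮)) := by
  ext ⟨c, n⟩
  simp only [mem_coverMonoid, AddSubmonoid.mem_map, AddMonoidHom.mem_eqLocusM]
  constructor
  · intro h
    refine ⟨fun j => match j with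
      | Sum.inl i => c i
      | Sum.inr (Sum.inl _) => n
      | Sum.inr (Sum.inr S) => (∑ i ∈ S.1, c i) - n, ?_, rfl⟩
    ext S
    change (∑ i ∈ S.1, c i) = n + ((∑ i ∈ S.1, c i) - n)
    have := h S.1 S.2
    omega
  · rintro ⟨t, ht, hct⟩ S hS
    have h := congrFun ht ⟨S, hS⟩
    change (∑ i ∈ S, t (Sum.inl i)) = t (Sum.inr (Sum.inl ())) + t (Sum.inr (Sum.inr ⟨S, hS⟩)) at h
    obtain ⟨rfl, rfl⟩ := Prod.mk.inj hct.symm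
    change t (Sum.inr (Sum.inl ())) ≤ ∑ i ∈ S, t (Sum.inl i)
    omega

/-- **Gordan's lemma for the cover monoid** (Herzog–Hibi–Trung 2007, Thm. 1.1 / Thm. 4.2 «finitely generated»):
`H(𝒮)` is a finitely generated monoid. [cite: HerzogHibiTrung2007, Thm. 1.1] -/
theorem coverMonoid_fg : (coverMonoid 𝒮).FG := by
  rw [coverMonoid_eq_map]
  exact (AddSubmonoid.fg_eqLocusM _ _).map _

end Gordan

/-! ## The Veronese lemma for a finitely generated graded submonoid of `ℕ^d × ℕ` -/

section Veronese

variable {H : AddSubmonoid ((Fin d → ℕ) × ℕ)} {G : Finset ((Fin d → ℕ) × ℕ)}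

/-- **Splitting off one block of degree `L`**: if `G` generates `H`, `L > 0` is a multiple of every positive
degree occurring in `G`, and `m` is the number of positive-degree generators, then every `h ∈ H` of degree
`≥ m L` with `m ≥ 1` is `u + h'` with `u, h' ∈ H` and `deg u = L` (pigeonhole on a representation
`h = ∑ a_g g`). [cite: HerzogHibiTrung2007, Thm. 2.1 (proof of (a) ⇒ (b))] -/
theorem exists_split_of_le_degree (hG : AddSubmonoid.closure (G : Set ((Fin d → ℕ) × ℕ)) = H) {L m : ℕ}
    (hL : ∀ g ∈ G, 0 < g.2 → g.2 ∣ L) (hGm : (G.filter fun g => 0 < g.2).card = m) (hm : 0 < m)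
    {h : (Fin d → ℕ) × ℕ} (hh : h ∈ H) (hdeg : m * L ≤ h.2) :
    ∃ u h' : (Fin d → ℕ) × ℕ, u ∈ H ∧ h' ∈ H ∧ u.2 = L ∧ h = u + h' := by
  classical
  rw [← hG, AddSubmonoid.mem_closure_finset] at hh
  obtain ⟨a, -, rfl⟩ := hh
  -- the degree is carried by the positive-degree generators
  have hdeg2 : (∑ g ∈ G, a g • g).2 = ∑ g ∈ G.filter (fun g => 0 < g.2), a g * g.2 := by
    rw [Prod.snd_sum, Finset.sum_filter]
    refine Finset.sum_congr rfl fun g _ => ?_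
    rw [Prod.smul_snd, smul_eq_mul]
    split_ifs with h0
    · rfl
    · have : g.2 = 0 := Nat.eq_zero_of_not_pos h0
      rw [this, mul_zero]
  -- pigeonhole: some positive generator carries at least `L`
  have hex : ∃ g ∈ G.filter (fun g => 0 < g.2), L ≤ a g * g.2 := by
    by_contra hcon
    push Not at hcon
    have hlt : (∑ g ∈ G.filter (fun g => 0 < g.2), a g * g.2) < m * L := by
      calc (∑ g ∈ G.filter (fun g => 0 < g.2), a g * g.2) < ∑ _g ∈ G.filter (fun g => 0 < g.2), L :=
            Finset.sum_lt_sum_of_nonempty (Finset.card_pos.mp (by omega)) fun g hg => hcon g hg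
        _ = m * L := by rw [Finset.sum_const, smul_eq_mul, hGm]
    rw [← hdeg2] at hlt
    omega
  obtain ⟨g₀, hg₀, hLg₀⟩ := hex
  have hg₀G : g₀ ∈ G := (Finset.mem_filter.mp hg₀).1
  have hg₀pos : 0 < g₀.2 := (Finset.mem_filter.mp hg₀).2
  obtain ⟨q, hq⟩ := hL g₀ hg₀G hg₀pos
  -- `q ≤ a g₀`
  have hqa : q ≤ a g₀ := by
    by_contra hlt
    push Not at hlt
    have : a g₀ * g₀.2 < q * g₀.2 := Nat.mul_lt_mul_of_pos_right hlt hg₀pos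
    rw [hq, mul_comm] at hLg₀
    omega
  refine ⟨q • g₀, ∑ g ∈ G, (Function.update a g₀ (a g₀ - q)) g • g, ?_, ?_, ?_, ?_⟩
  · rw [← hG]
    exact AddSubmonoid.nsmul_mem _ (AddSubmonoid.subset_closure hg₀G) q
  · rw [← hG]
    exact AddSubmonoid.sum_mem _ fun g hg => AddSubmonoid.nsmul_mem _ (AddSubmonoid.subset_closure hg) _
  · rw [Prod.smul_snd, smul_eq_mul, hq, mul_comm]
  · -- `∑ a_g g = q g₀ + ∑ a'_g g`
    rw [← Finset.add_sum_erase G _ hg₀G, ← Finset.add_sum_erase G (fun g => Function.update a g₀ (a g₀ - q) g • g) hg₀G,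
      Function.update_self, ← add_assoc, ← add_nsmul, Nat.add_sub_cancel' hqa]
    congr 1
    refine Finset.sum_congr rfl fun g hg => ?_
    rw [Function.update_of_ne (Finset.ne_of_mem_erase hg)]

/-- **Splitting off a block of degree `(j+1) L`** (iteration of `exists_split_of_le_degree`): every `h ∈ H` of
degree `≥ m L + j L` is `u + h'` with `u, h' ∈ H`, `deg u = (j + 1) L`. [cite: HerzogHibiTrung2007, Thm. 2.1 (proof)] -/
theorem exists_split_iterate (hG : AddSubmonoid.closure (G : Set ((Fin d → ℕ) × ℕ)) = H) {L m : ℕ}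
    (hL : ∀ g ∈ G, 0 < g.2 → g.2 ∣ L) (hGm : (G.filter fun g => 0 < g.2).card = m) (hm : 0 < m) :
    ∀ (j : ℕ) {h : (Fin d → ℕ) × ℕ}, h ∈ H → m * L + j * L ≤ h.2 →
      ∃ u h' : (Fin d → ℕ) × ℕ, u ∈ H ∧ h' ∈ H ∧ u.2 = (j + 1) * L ∧ h = u + h' := by
  intro j
  induction j with
  | zero =>
    intro h hh hdeg
    rw [zero_add, one_mul]
    exact exists_split_of_le_degree hG hL hGm hm hh (by omega)
  | succ j ih =>
    intro h hh hdeg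
    obtain ⟨u₀, h₀, hu₀, hh₀, hdu₀, rfl⟩ := exists_split_of_le_degree hG hL hGm hm hh (by nlinarith)
    have hdeg₀ : m * L + j * L ≤ h₀.2 := by
      have : (u₀ + h₀).2 = u₀.2 + h₀.2 := rfl
      rw [this, hdu₀] at hdeg
      nlinarith
    obtain ⟨u₁, h₁, hu₁, hh₁, hdu₁, rfl⟩ := ih hh₀ hdeg₀
    refine ⟨u₀ + u₁, h₁, H.add_mem hu₀ hu₁, hh₁, ?_, (add_assoc _ _ _).symm⟩
    change u₀.2 + u₁.2 = (j + 1 + 1) * L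
    rw [hdu₀, hdu₁]
    ring

/-- **Standard Veronese of a finitely generated graded submonoid of `ℕ^d × ℕ`** (Herzog–Hibi–Trung 2007,
Thm. 2.1 (a) ⇒ (b), monoid form): with `e = m L` (`m ≥ 1` positive-degree generators, `L > 0` a common multiple
of their degrees), every `h ∈ H` of degree `k e` is a sum of `k` elements of `H` of degree `e` — up to the
degree-`0` part when `k = 0`, whence the inequality on the first component.
[cite: HerzogHibiTrung2007, Thm. 2.1] -/
theorem exists_sum_of_degree_mul (hG : AddSubmonoid.closure (G : Set ((Fin d → ℕ) × ℕ)) = H) {L m : ℕ}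
    (hL : ∀ g ∈ G, 0 < g.2 → g.2 ∣ L) (hGm : (G.filter fun g => 0 < g.2).card = m) (hm : 0 < m) :
    ∀ (k : ℕ) {h : (Fin d → ℕ) × ℕ}, h ∈ H → h.2 = k * (m * L) →
      ∃ hs : Fin k → (Fin d → ℕ) × ℕ, (∀ j, hs j ∈ H ∧ (hs j).2 = m * L) ∧ (∑ j, hs j).1 ≤ h.1 := by
  intro k
  induction k with
  | zero =>
    intro h _ _
    exact ⟨Fin.elim0, fun j => j.elim0, by simp⟩
  | succ k ih =>
    intro h hh hdeg
    rcases Nat.eq_zero_or_pos k with rfl | hk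
    · -- `k + 1 = 1`: `h` itself
      refine ⟨fun _ => h, fun _ => ⟨hh, by rw [hdeg]; ring⟩, ?_⟩
      simp
    · -- peel a block of degree `m L`, then induct
      have hm1 : 1 ≤ m := hm
      obtain ⟨u, h', hu, hh', hdu, rfl⟩ :=
        exists_split_iterate hG hL hGm hm (m - 1) hh (by
          rw [hdeg]
          have h2 : m * L + (m - 1) * L ≤ 2 * (m * L) := by
            zify [hm1]
            nlinarith
          have h3 : 2 * (m * L) ≤ (k + 1) * (m * L) := Nat.mul_le_mul_right _ (by omega)
          exact h2.trans h3)
      have hdu' : u.2 = m * L := by rw [hdu, Nat.sub_add_cancel hm1]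
      have hdeg' : h'.2 = k * (m * L) := by
        have : (u + h').2 = u.2 + h'.2 := rfl
        rw [this, hdu'] at hdeg
        nlinarith
      obtain ⟨hs, hhs, hsum⟩ := ih hh' hdeg'
      refine ⟨Fin.cons u hs, fun j => ?_, ?_⟩
      · refine Fin.cases ?_ (fun j => ?_) j
        · simpa using ⟨hu, hdu'⟩
        · simpa using hhs j
      · rw [Fin.sum_univ_succ]
        simp only [Fin.cons_zero, Fin.cons_succ, Prod.fst_add]
        exact add_le_add le_rfl hsum

end Veronese

/-! ## The standard Veronese level of the cover monoid -/

/-- **Herzog–Hibi–Trung 2007, Cor. 2.2 (combinatorial form) — a STANDARD VERONESE LEVEL EXISTS**: for every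
finite family `𝒮` of subsets of `Fin d` there is `b₀ > 0` such that for every `k`, every exponent `c` with
`S`-degree `≥ k b₀` for all `S ∈ 𝒮` dominates a sum `c_1 + ⋯ + c_k ≤ c` of exponents `c_j` each of `S`-degree
`≥ b₀` for all `S ∈ 𝒮` («there exists an integer `d` such that `(⋂_j I_j^d)^k = ⋂_j I_j^{dk}` for all `k ≥ 1`»,
for the monomial primes `I_j = 𝔭_{S_j}`). Proof: Gordan (`coverMonoid_fg`) + the Veronese lemma
(`exists_sum_of_degree_mul`). [cite: HerzogHibiTrung2007, Cor. 2.2] -/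
theorem exists_veronese_level (𝒮 : Finset (Finset (Fin d))) :
    ∃ b₀ : ℕ, 0 < b₀ ∧ ∀ (k : ℕ) (c : Fin d → ℕ), Covers 𝒮 (k * b₀) c →
      ∃ cs : Fin k → Fin d → ℕ, (∀ j, Covers 𝒮 b₀ (cs j)) ∧ ∑ j, cs j ≤ c := by
  classical
  obtain ⟨G, hG⟩ := coverMonoid_fg 𝒮
  rcases Nat.eq_zero_or_pos (G.filter fun g => 0 < g.2).card with h0 | hm
  · -- no positive-degree generator: only degree `0` occurs, `b₀ = 1` works vacuously for `k ≥ 1`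
    refine ⟨1, Nat.one_pos, fun k c hc => ?_⟩
    rcases Nat.eq_zero_or_pos k with rfl | hk
    · exact ⟨Fin.elim0, fun j => j.elim0, by simp⟩
    · exfalso
      have hmem : (c, k * 1) ∈ coverMonoid 𝒮 := hc
      rw [← hG, AddSubmonoid.mem_closure_finset] at hmem
      obtain ⟨a, -, ha⟩ := hmem
      have h2 : (∑ g ∈ G, a g • g).2 = 0 := by
        rw [Prod.snd_sum]
        refine Finset.sum_eq_zero fun g hg => ?_
        rw [Prod.smul_snd, smul_eq_mul]
        have : g.2 = 0 := by
          by_contra hne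
          have hmem : g ∈ G.filter (fun g => 0 < g.2) := Finset.mem_filter.mpr ⟨hg, Nat.pos_of_ne_zero hne⟩
          rw [Finset.card_eq_zero] at h0
          rw [h0] at hmem
          simp at hmem
        rw [this, mul_zero]
      rw [ha] at h2
      change k * 1 = 0 at h2
      omega
  · -- `b₀ = m L`, `L = ∏` of the positive degrees
    have hL0 : 0 < ∏ g ∈ G.filter (fun g => 0 < g.2), g.2 :=
      Finset.prod_pos fun g hg => (Finset.mem_filter.mp hg).2
    have hL : ∀ g ∈ G, 0 < g.2 → g.2 ∣ ∏ g ∈ G.filter (fun g => 0 < g.2), g.2 := fun g hg hpos =>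
      Finset.dvd_prod_of_mem _ (Finset.mem_filter.mpr ⟨hg, hpos⟩)
    refine ⟨(G.filter fun g => 0 < g.2).card * ∏ g ∈ G.filter (fun g => 0 < g.2), g.2, Nat.mul_pos hm hL0,
      fun k c hc => ?_⟩
    have hmem : (c, k * ((G.filter fun g => 0 < g.2).card * ∏ g ∈ G.filter (fun g => 0 < g.2), g.2)) ∈
        coverMonoid 𝒮 := hc
    obtain ⟨hs, hhs, hsum⟩ := exists_sum_of_degree_mul hG hL rfl hm k hmem rfl
    refine ⟨fun j => (hs j).1, fun j => ?_, ?_⟩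
    · have h1 := (hhs j).1
      rw [mem_coverMonoid, (hhs j).2] at h1
      exact h1
    · have : (∑ j, hs j).1 = ∑ j, (hs j).1 := Prod.fst_sum
      rw [← this]
      exact hsum

/-- **Multiples of a good level are good**: if `b₀` is a standard Veronese level for `𝒮` then so is `m b₀`
for every `m ≥ 1` (HHT Rem. 2.4: the good levels are NOT eventually all of `ℕ`, so downstream uniformity over
finitely many families goes through common multiples). [cite: HerzogHibiTrung2007, Thm. 2.1 and Rem. 2.4] -/
theorem veronese_level_mul {𝒮 : Finset (Finset (Fin d))} {b₀ : ℕ}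
    (h : ∀ (k : ℕ) (c : Fin d → ℕ), Covers 𝒮 (k * b₀) c →
      ∃ cs : Fin k → Fin d → ℕ, (∀ j, Covers 𝒮 b₀ (cs j)) ∧ ∑ j, cs j ≤ c)
    (m : ℕ) :
    ∀ (k : ℕ) (c : Fin d → ℕ), Covers 𝒮 (k * (m * b₀)) c →
      ∃ cs : Fin k → Fin d → ℕ, (∀ j, Covers 𝒮 (m * b₀) (cs j)) ∧ ∑ j, cs j ≤ c := by
  intro k c hc
  rw [← mul_assoc] at hc
  obtain ⟨cs, hcs, hsum⟩ := h (k * m) c hc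
  -- group the `k m` summands into `k` blocks of `m`
  refine ⟨fun j => ∑ i : Fin m, cs (finProdFinEquiv (j, i)), fun j => ?_, ?_⟩
  · have := Covers.sum (𝒮 := 𝒮) Finset.univ (n := fun _ : Fin m => b₀)
      (c := fun i : Fin m => cs (finProdFinEquiv (j, i))) fun i _ => hcs _
    simpa [Finset.sum_const, smul_eq_mul] using this
  · calc (∑ j : Fin k, ∑ i : Fin m, cs (finProdFinEquiv (j, i)))
        = ∑ ji : Fin k × Fin m, cs (finProdFinEquiv ji) := (Finset.sum_product' _ _ _).symm.trans (by rfl)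
      _ = ∑ l : Fin (k * m), cs l := by
          exact Fintype.sum_equiv finProdFinEquiv _ _ fun _ => rfl
      _ ≤ c := hsum

end Literature.Combinatorics.Optimization.CoverMonoid
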